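import Literature.MathematicalPhysics.QuantumFieldTheory.LatticeGaugeProofs
import Literature.MathematicalPhysics.QuantumLattice.WilsonLoopsProofs
import Literature.RepresentationTheory.CompactGroups.UnitaryTrick
import HarnessLib

/-!
# Static potential of infinite-volume lattice gauge states (S12): proofs, part 1

Sibling proofs file of `LatticeGauge.lean` for the named fact
`Literature.MathematicalPhysics.QuantumFieldTheory.exists_hasStaticPotential` (constructive-qft.S12:
the transfer-matrix dichotomy for the rectangular Wilson loop expectations `W(R,T)` of an
infinite-volume limit state and the existence of the static potential
`V(R) = -lim_T T⁻¹ log W(R,T)`; E. Seiler, LNP 159 (1982) §2, from Osterwalder–Seiler reflection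
positivity, Ann. Phys. 110 (1978) 440, §2; S. Chatterjee, arXiv:1803.01950 §4 for the definition
of `V(R)`). This file only PROVES; it declares no named fact. It contains the two model-free
ingredients of the proof:

* **(A) the log-convexity dichotomy** (`StaticPotential.dichotomy_of_logConvex`,
  `StaticPotential.dichotomy_rectExpectation`): a real sequence `W` with `W 0 = 1`, `0 ≤ W ≤ 1`
  and `W(T+1)² ≤ W(T) W(T+2)` (the inequalities which reflection positivity in hyperplanes with
  and without sites gives for `T ↦ W(R,T)`) either vanishes for all `T ≥ 1`, or is positive with
  `log W` convex, and then `-log W(T) / T` converges to some `V ∈ [0, ∞)` (monotone increments +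
  Cesàro); the second alternative is exactly `HasStaticPotential`.
* **(B) the coordinate-permutation symmetry**: the torus Wilson state `μ_{Λ_L,β}` is invariant
  under permutations of the coordinate axes (`wilsonMeasure_map_configPerm`: product Haar measure
  is invariant under relabelling the edges, and the Wilson action is invariant because
  `Re tr ρ(g⁻¹) = Re tr ρ(g)` for a continuous representation of a compact group,
  `CompactGroup.re_trace_map_inv`), hence coordinate permutations map infinite-volume limit
  points to limit points along the same tori (`map_configPermZd_mem_infiniteVolumeLimitPoints`),
  and the `R × T` loop expectation in the `(0,1)` plane of `μ` is the `T × R` loop expectation of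
  the swapped state (`rectExpectation_eq_swap`). This reduces the static potential in the
  direction `1` of the tree's `HasStaticPotential` to the time direction `0` of the tree's
  reflection-positivity theorem `wilsonExpectation_reflectionPositive`.

References: E. Seiler, *Gauge Theories as a Problem of Constructive Quantum Field Theory and
Statistical Mechanics*, LNP 159 (1982), §2; K. Osterwalder, E. Seiler, Ann. Phys. 110 (1978)
440, §2; S. Chatterjee, arXiv:1803.01950, §4. [folklore]
-/

noncomputable section

open MeasureTheory Filter Topology
open Literature.MathematicalPhysics.QuantumLattice Literature.Probability.LatticeModels

namespace Literature.MathematicalPhysics.QuantumFieldTheory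

namespace StaticPotential

/-! ### (A) The log-convexity dichotomy -/

/-- If `W ≥ 0` is log-convex (`W(n+1)² ≤ W(n) W(n+2)`) and `W 0, W 1 > 0`, then `W > 0`
everywhere (two-step induction). [folklore] -/
theorem pos_of_logConvex {W : ℕ → ℝ} (h0 : 0 < W 0) (h1 : 0 < W 1) (hnn : ∀ n, 0 ≤ W n)
    (hconv : ∀ n, W (n + 1) ^ 2 ≤ W n * W (n + 2)) : ∀ n, 0 < W n := by
  have key : ∀ n, 0 < W n ∧ 0 < W (n + 1) := by
    intro n
    induction n with
    | zero => exact ⟨h0, h1⟩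
    | succ n ih =>
      refine ⟨ih.2, ?_⟩
      by_contra hneg
      have hz : W (n + 2) = 0 := le_antisymm (not_lt.1 hneg) (hnn _)
      have h := hconv n
      rw [hz, mul_zero] at h
      exact absurd h (not_le.2 (pow_pos ih.2 2))
  exact fun n => (key n).1

/-- If `W ≥ 0` is log-convex and `W 1 = 0`, then `W n = 0` for all `n ≥ 1`. [folklore] -/
theorem eq_zero_of_logConvex {W : ℕ → ℝ} (h1 : W 1 = 0)
    (hconv : ∀ n, W (n + 1) ^ 2 ≤ W n * W (n + 2)) : ∀ n, 1 ≤ n → W n = 0 := by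
  intro n hn
  induction n with
  | zero => omega
  | succ n ih =>
    rcases Nat.eq_zero_or_pos n with rfl | hpos
    · exact h1
    · have hWn := ih hpos
      have h := hconv n
      rw [hWn, zero_mul] at h
      have hsq : W (n + 1) ^ 2 = 0 := le_antisymm h (sq_nonneg _)
      exact (pow_eq_zero_iff two_ne_zero).1 hsq

/-- **The log-convexity dichotomy.** Let `W : ℕ → ℝ` satisfy `W 0 = 1`, `0 ≤ W n ≤ 1` and
`W(n+1)² ≤ W(n) W(n+2)` for all `n`. Then either `W n = 0` for all `n ≥ 1`, or `W n > 0` for all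
`n` and `-log W(n) / n → V` for some `V ≥ 0`. (The increments of the convex sequence `log W ≤ 0`
are non-decreasing and `≤ 0`, hence converge; Cesàro.) This is the elementary half of the
transfer-matrix argument for the static potential (Seiler LNP 159 §2). [folklore] -/
theorem dichotomy_of_logConvex {W : ℕ → ℝ} (h0 : W 0 = 1) (hle : ∀ n, W n ≤ 1)
    (hnn : ∀ n, 0 ≤ W n) (hconv : ∀ n, W (n + 1) ^ 2 ≤ W n * W (n + 2)) :
    (∀ n, 1 ≤ n → W n = 0) ∨
      ((∀ n, 0 < W n) ∧ ∃ V : ℝ, 0 ≤ V ∧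
        Tendsto (fun n : ℕ => -Real.log (W n) / n) atTop (𝓝 V)) := by
  by_cases h1 : W 1 = 0
  · exact Or.inl (eq_zero_of_logConvex h1 hconv)
  right
  have h1pos : 0 < W 1 := lt_of_le_of_ne (hnn 1) (Ne.symm h1)
  have hpos : ∀ n, 0 < W n := pos_of_logConvex (by rw [h0]; exact one_pos) h1pos hnn hconv
  refine ⟨hpos, ?_⟩
  set a : ℕ → ℝ := fun n => Real.log (W n) with ha
  set δ : ℕ → ℝ := fun n => a (n + 1) - a n with hδ
  have ha0 : a 0 = 0 := by simp [ha, h0]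
  have hale : ∀ n, a n ≤ 0 := fun n => Real.log_nonpos (hnn n) (hle n)
  have hconv' : ∀ n, 2 * a (n + 1) ≤ a n + a (n + 2) := by
    intro n
    have h := Real.log_le_log (pow_pos (hpos (n + 1)) 2) (hconv n)
    rw [Real.log_pow, Real.log_mul (hpos n).ne' (hpos (n + 2)).ne'] at h
    simpa [ha] using h
  have hmono : Monotone δ := monotone_nat_of_le_succ fun n => by
    simp only [hδ]
    have := hconv' n
    linarith
  have hδle : ∀ n, δ n ≤ 0 := by
    intro m
    by_contra hm
    have hm : 0 < δ m := not_le.1 hm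
    have hgrow : ∀ k : ℕ, a m + k * δ m ≤ a (m + k) := by
      intro k
      induction k with
      | zero => simp
      | succ k ih =>
        have hstep : δ m ≤ δ (m + k) := hmono (Nat.le_add_right m k)
        simp only [hδ] at hstep
        rw [show m + (k + 1) = m + k + 1 by omega]
        push_cast
        linarith
    obtain ⟨k, hk⟩ := exists_nat_gt (-a m / δ m)
    have hk' : -a m < k * δ m := (div_lt_iff₀ hm).1 hk
    have h' : 0 < a m + k * δ m := by linarith
    exact absurd ((h'.trans_le (hgrow k)).trans_le (hale _)) (lt_irrefl 0)
  have hbdd : BddAbove (Set.range δ) := ⟨0, by rintro _ ⟨n, rfl⟩; exact hδle n⟩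
  have hδlim : Tendsto δ atTop (𝓝 (⨆ n, δ n)) := tendsto_atTop_ciSup hmono hbdd
  have hLle : (⨆ n, δ n) ≤ 0 := ciSup_le hδle
  refine ⟨-(⨆ n, δ n), by linarith, ?_⟩
  have hces := hδlim.cesaro
  have hsum : ∀ n, ∑ i ∈ Finset.range n, δ i = a n := by
    intro n
    simp only [hδ]
    rw [Finset.sum_range_sub, ha0, sub_zero]
  simp only [hsum] at hces
  have heq : (fun n : ℕ => -Real.log (W n) / n) = fun n : ℕ => -((n : ℝ)⁻¹ * a n) := by
    funext n
    simp only [ha]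
    ring
  rw [heq]
  exact hces.neg

/-- **The dichotomy for rectangular Wilson loop expectations.** If the `R × T` loop
expectations `W(T) = W_μ(R, T)` (`rectExpectation μ χ 0 1 R T`) satisfy `W(0) = 1`,
`0 ≤ W(T) ≤ 1` and the log-convexity `W(T+1)² ≤ W(T) W(T+2)`, then either `W(T) = 0` for all
`T ≥ 1` or the static potential exists with `0 ≤ V` (`HasStaticPotential μ χ R V`). This is the
shape of the conclusion of `exists_hasStaticPotential` (Seiler LNP 159 §2). [folklore] -/
theorem dichotomy_rectExpectation {G : Type*} [Group G] [MeasurableSpace G] {d : ℕ} [NeZero d]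
    (μ : Measure (LGConfig d G)) (χ : G → ℝ) (R : ℕ)
    (h0 : rectExpectation μ χ 0 1 R 0 = 1) (hle : ∀ T, rectExpectation μ χ 0 1 R T ≤ 1)
    (hnn : ∀ T, 0 ≤ rectExpectation μ χ 0 1 R T)
    (hconv : ∀ T, rectExpectation μ χ 0 1 R (T + 1) ^ 2 ≤
      rectExpectation μ χ 0 1 R T * rectExpectation μ χ 0 1 R (T + 2)) :
    (∀ T, 1 ≤ T → rectExpectation μ χ 0 1 R T = 0) ∨
      ∃ V : ℝ, 0 ≤ V ∧ HasStaticPotential μ χ R V := by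
  rcases dichotomy_of_logConvex h0 hle hnn hconv with h | ⟨hpos, V, hV, hlim⟩
  · exact Or.inl h
  · refine Or.inr ⟨V, hV, Eventually.of_forall fun T => (hpos T).ne', ?_⟩
    refine hlim.congr fun T => ?_
    rw [abs_of_pos (hpos T)]

/-! ### (B) Coordinate permutations: a combinatorial lemma -/

/-- A symmetric function on `Fin d × Fin d` vanishing on the diagonal sums over the pairs
`i < j` to half of its full double sum. [folklore] -/
theorem sum_lt_eq_half_sum {d : ℕ} (f : Fin d → Fin d → ℝ) (hsymm : ∀ i j, f i j = f j i)
    (hdiag : ∀ i, f i i = 0) :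
    ∑ q : {q : Fin d × Fin d // q.1 < q.2}, f q.1.1 q.1.2 = (1 / 2) * ∑ i, ∑ j, f i j := by
  have hsplit : ∑ i, ∑ j, f i j =
      ∑ i, ∑ j, ((if i < j then f i j else 0) + (if j < i then f i j else 0)) := by
    refine Finset.sum_congr rfl fun i _ => Finset.sum_congr rfl fun j _ => ?_
    rcases lt_trichotomy i j with h | rfl | h
    · simp [h, not_lt.2 h.le]
    · simp [hdiag]
    · simp [h, not_lt.2 h.le]
  have h1 : ∑ i, ∑ j, (if i < j then f i j else 0) =
      ∑ q : {q : Fin d × Fin d // q.1 < q.2}, f q.1.1 q.1.2 := by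
    rw [← Finset.sum_product' (s := Finset.univ) (t := Finset.univ)
      (f := fun i j => if i < j then f i j else 0), Finset.univ_product_univ, ← Finset.sum_filter]
    exact Finset.sum_subtype _ (fun q => by simp) fun q : Fin d × Fin d => f q.1 q.2
  have h2 : ∑ i, ∑ j, (if j < i then f i j else 0) = ∑ i, ∑ j, (if i < j then f i j else 0) := by
    rw [Finset.sum_comm]
    refine Finset.sum_congr rfl fun i _ => Finset.sum_congr rfl fun j _ => ?_
    split_ifs
    · exact hsymm _ _
    · rfl
  rw [hsplit, Finset.sum_congr rfl fun i _ => Finset.sum_add_distrib, Finset.sum_add_distrib, h2,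
    h1]
  ring

end StaticPotential

/-! ### (B) Coordinate permutations of the torus -/

section TorusPerm

variable {d L N : ℕ} {G : Type*}

/-- Permuting the coordinate axes of torus sites: `(sitePerm π x) j = x (π⁻¹ j)`. [folklore] -/
def sitePerm (π : Equiv.Perm (Fin d)) : Site d L ≃ Site d L :=
  Equiv.arrowCongr π (Equiv.refl (ZMod L))

/-- `sitePerm` evaluated. [folklore] -/
@[simp] theorem sitePerm_apply (π : Equiv.Perm (Fin d)) (x : Site d L) (j : Fin d) :
    sitePerm π x j = x (π.symm j) := rfl

/-- `sitePerm` is additive. [folklore] -/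
theorem sitePerm_add (π : Equiv.Perm (Fin d)) (x y : Site d L) :
    sitePerm π (x + y) = sitePerm π x + sitePerm π y := rfl

/-- `sitePerm` maps the unit vector `c eᵢ` to `c e_{π i}`. [folklore] -/
@[simp] theorem sitePerm_single (π : Equiv.Perm (Fin d)) (i : Fin d) (c : ZMod L) :
    sitePerm π (Pi.single i c : Site d L) = Pi.single (π i) c := by
  funext j
  simp only [sitePerm_apply, Pi.single_apply, Equiv.symm_apply_eq]

/-- `sitePerm` intertwines the shifts: `π (x + eᵢ) = π x + e_{π i}`. [folklore] -/
theorem sitePerm_shift (π : Equiv.Perm (Fin d)) (x : Site d L) (i : Fin d) :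
    sitePerm π (x.shift i) = (sitePerm π x).shift (π i) := by
  simp only [Site.shift, sitePerm_add, sitePerm_single]

/-- The induced permutation of the positively oriented edges: `(x, i) ↦ (π x, π i)`. [folklore] -/
def edgePerm (π : Equiv.Perm (Fin d)) : Edge d L ≃ Edge d L := (sitePerm π).prodCongr π

variable [MeasurableSpace G]

/-- The induced map on torus gauge configurations, `(configPerm π U) (x, i) = U (π⁻¹ x, π⁻¹ i)`, as
a measurable equivalence (Mathlib `MeasurableEquiv.arrowCongr'`). [folklore] -/
def configPerm (π : Equiv.Perm (Fin d)) : GaugeConfig d L G ≃ᵐ GaugeConfig d L G :=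
  MeasurableEquiv.arrowCongr' (edgePerm π) (MeasurableEquiv.refl G)

/-- `configPerm` evaluated. [folklore] -/
@[simp] theorem configPerm_apply (π : Equiv.Perm (Fin d)) (U : GaugeConfig d L G) (e : Edge d L) :
    configPerm π U e = U (sitePerm π.symm e.1, π.symm e.2) := by
  change U ((edgePerm π).symm e) = _
  rfl

variable [Group G] (ρ : G →* Matrix (Fin N) (Fin N) ℂ)

/-- Plaquette holonomies of the permuted configuration. [folklore] -/
theorem plaquetteHolonomy_configPerm (π : Equiv.Perm (Fin d)) (U : GaugeConfig d L G)
    (x : Site d L) (i j : Fin d) :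
    plaquetteHolonomy (configPerm π U) x i j =
      plaquetteHolonomy U (sitePerm π.symm x) (π.symm i) (π.symm j) := by
  simp only [plaquetteHolonomy, configPerm_apply, sitePerm_shift]

omit [MeasurableSpace G] in
/-- The degenerate plaquette holonomy `U_{x,i,i}` is `1`. [folklore] -/
theorem plaquetteHolonomy_self (U : GaugeConfig d L G) (x : Site d L) (i : Fin d) :
    plaquetteHolonomy U x i i = 1 := by
  simp [plaquetteHolonomy]

omit [MeasurableSpace G] in
/-- Exchanging the two directions inverts the plaquette holonomy. [folklore] -/
theorem plaquetteHolonomy_swap (U : GaugeConfig d L G) (x : Site d L) (i j : Fin d) :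
    plaquetteHolonomy U x j i = (plaquetteHolonomy U x i j)⁻¹ := by
  simp only [plaquetteHolonomy, mul_inv_rev, inv_inv, mul_assoc]

variable [TopologicalSpace G] [IsTopologicalGroup G] [CompactSpace G] [BorelSpace G]

omit [MeasurableSpace G] [BorelSpace G] in
/-- The Wilson action as half the sum over all ordered pairs of directions (the diagonal terms
vanish and `Re tr ρ(U_p⁻¹) = Re tr ρ(U_p)` for a continuous representation of a compact group).
[folklore] -/
theorem wilsonAction_eq_half_sum [NeZero L] (hρ : Continuous ρ) (U : GaugeConfig d L G) :
    wilsonAction ρ U = ∑ x : Site d L, (1 / 2) * ∑ i : Fin d, ∑ j : Fin d,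
      ((N : ℝ) - (ρ (plaquetteHolonomy U x i j)).trace.re) := by
  unfold wilsonAction
  rw [Fintype.sum_prod_type]
  refine Finset.sum_congr rfl fun x _ => ?_
  refine StaticPotential.sum_lt_eq_half_sum
    (fun i j => (N : ℝ) - (ρ (plaquetteHolonomy U x i j)).trace.re) (fun i j => ?_) (fun i => ?_)
  · simp only [plaquetteHolonomy_swap U x i j,
      Literature.RepresentationTheory.CompactGroups.CompactGroup.re_trace_map_inv ρ hρ]
  · simp [plaquetteHolonomy_self, Matrix.trace_one]

omit [BorelSpace G] in
/-- **The Wilson action is invariant under permutations of the coordinate axes.** [folklore] -/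
theorem wilsonAction_configPerm [NeZero L] (hρ : Continuous ρ) (π : Equiv.Perm (Fin d))
    (U : GaugeConfig d L G) :
    wilsonAction ρ (configPerm π U) = wilsonAction ρ U := by
  rw [wilsonAction_eq_half_sum ρ hρ, wilsonAction_eq_half_sum ρ hρ]
  simp only [plaquetteHolonomy_configPerm]
  refine Fintype.sum_equiv (sitePerm π.symm) _ _ fun x => ?_
  congr 1
  exact Fintype.sum_equiv π.symm _ _ fun i => Fintype.sum_equiv π.symm _ _ fun j => rfl

/-- **The torus Wilson state is invariant under permutations of the coordinate axes.** [folklore] -/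
theorem wilsonMeasure_map_configPerm [NeZero L] (hρ : Continuous ρ) (β : ℝ)
    (π : Equiv.Perm (Fin d)) :
    (wilsonMeasure ρ β).map (configPerm π) = wilsonMeasure (d := d) (L := L) (G := G) ρ β := by
  have hπ : (Measure.pi fun _ : Edge d L => haarProbability G).map (configPerm (G := G) π) =
      Measure.pi fun _ : Edge d L => haarProbability G :=
    (measurePreserving_arrowCongr' (fun _ : Edge d L => haarProbability G)
      (fun _ : Edge d L => haarProbability G) (edgePerm π) (MeasurableEquiv.refl G)
      fun _ => MeasurePreserving.id _).map_eq
  simp only [wilsonMeasure, Measure.map_smul, wilsonWeight]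
  rw [withDensity_map_of_measurableEquiv _ _ _ hπ]
  intro U
  rw [wilsonAction_configPerm ρ hρ]

/-- Torus Wilson expectations are invariant under permutations of the coordinate axes. [folklore] -/
theorem wilsonExpectation_comp_configPerm [NeZero L] (hρ : Continuous ρ) {V : Type*}
    [NormedAddCommGroup V] [NormedSpace ℝ V] (β : ℝ) (π : Equiv.Perm (Fin d))
    (F : GaugeConfig d L G → V) :
    wilsonExpectation ρ β (F ∘ configPerm π) = wilsonExpectation ρ β F := by
  simp only [wilsonExpectation, Function.comp_apply]
  rw [← integral_map_equiv, wilsonMeasure_map_configPerm ρ hρ]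

end TorusPerm

/-! ### (B) Coordinate permutations of `ℤ^d`, limit points and rectangular loops -/

section ZdPerm

variable {d N : ℕ} {G : Type*}

/-- Permuting the coordinate axes of `ℤ^d`: `(sitePermZd π x) j = x (π⁻¹ j)`. [folklore] -/
def sitePermZd (π : Equiv.Perm (Fin d)) :
    Literature.Probability.LatticeModels.Site d ≃ Literature.Probability.LatticeModels.Site d :=
  Equiv.arrowCongr π (Equiv.refl ℤ)

/-- `sitePermZd` evaluated. [folklore] -/
@[simp] theorem sitePermZd_apply (π : Equiv.Perm (Fin d))
    (x : Literature.Probability.LatticeModels.Site d) (j : Fin d) :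
    sitePermZd π x j = x (π.symm j) := rfl

/-- `sitePermZd` is additive. [folklore] -/
theorem sitePermZd_add (π : Equiv.Perm (Fin d)) (x y : Literature.Probability.LatticeModels.Site d) :
    sitePermZd π (x + y) = sitePermZd π x + sitePermZd π y := rfl

/-- `sitePermZd` maps `c eᵢ` to `c e_{π i}`. [folklore] -/
@[simp] theorem sitePermZd_single (π : Equiv.Perm (Fin d)) (i : Fin d) (c : ℤ) :
    sitePermZd π (Pi.single i c : Literature.Probability.LatticeModels.Site d) = Pi.single (π i) c := by
  funext j
  simp only [sitePermZd_apply, Pi.single_apply, Equiv.symm_apply_eq]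

/-- `sitePermZd π 0 = 0`. [folklore] -/
@[simp] theorem sitePermZd_zero (π : Equiv.Perm (Fin d)) :
    sitePermZd π (0 : Literature.Probability.LatticeModels.Site d) = 0 := rfl

/-- The induced permutation of the positively oriented edges of `ℤ^d`. [folklore] -/
def edgePermZd (π : Equiv.Perm (Fin d)) : ZdEdge d ≃ ZdEdge d := (sitePermZd π).prodCongr π

variable [MeasurableSpace G]

/-- The induced map on gauge configurations on `ℤ^d`,
`(configPermZd π U) (x, i) = U (π⁻¹ x, π⁻¹ i)`, as a measurable equivalence. [folklore] -/
def configPermZd (π : Equiv.Perm (Fin d)) : LGConfig d G ≃ᵐ LGConfig d G :=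
  MeasurableEquiv.arrowCongr' (edgePermZd π) (MeasurableEquiv.refl G)

/-- `configPermZd` evaluated. [folklore] -/
@[simp] theorem configPermZd_apply (π : Equiv.Perm (Fin d)) (U : LGConfig d G) (e : ZdEdge d) :
    configPermZd π U e = U (sitePermZd π.symm e.1, π.symm e.2) := by
  change U ((edgePermZd π).symm e) = _
  rfl

/-- The periodic lift intertwines the coordinate permutations of `ℤ^d` and of the torus. [folklore] -/
theorem toTorusObservable_comp_configPermZd {α : Type*} (L : ℕ) (π : Equiv.Perm (Fin d))
    (F : LGConfig d G → α) :
    toTorusObservable L (F ∘ configPermZd π) = toTorusObservable L F ∘ configPerm π := by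
  funext U
  simp only [toTorusObservable, Function.comp_apply]
  congr 1

/-- A coordinate permutation of a cylinder observable is a cylinder observable. [folklore] -/
theorem IsCylinder.comp_configPermZd {α : Type*} {F : LGConfig d G → α} {S : Finset (ZdEdge d)}
    (hF : IsCylinder F S) (π : Equiv.Perm (Fin d)) :
    IsCylinder (F ∘ configPermZd π) (S.image fun e => (sitePermZd π.symm e.1, π.symm e.2)) := by
  intro U V hUV
  simp only [Function.comp_apply]
  refine hF fun e he => ?_
  simp only [configPermZd_apply]
  exact hUV _ (Finset.mem_coe.2 (Finset.mem_image.2 ⟨e, Finset.mem_coe.1 he, rfl⟩))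

/-- The coordinate permutation of configurations is continuous. [folklore] -/
theorem continuous_configPermZd [TopologicalSpace G] (π : Equiv.Perm (Fin d)) :
    Continuous (configPermZd (G := G) π : LGConfig d G → LGConfig d G) := by
  have : (configPermZd (G := G) π : LGConfig d G → LGConfig d G) =
      fun U e => U (sitePermZd π.symm e.1, π.symm e.2) := by
    funext U e; exact configPermZd_apply π U e
  rw [this]
  fun_prop

variable [Group G] [TopologicalSpace G] [IsTopologicalGroup G] [CompactSpace G] [BorelSpace G]
  (ρ : G →* Matrix (Fin N) (Fin N) ℂ)

/-- **Coordinate permutations of limit points are limit points**, along the same subsequence of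
tori: the torus Wilson states are invariant under `configPerm π` and the periodic lift
intertwines. [folklore] -/
theorem map_configPermZd_mem_infiniteVolumeLimitPoints (hρ : Continuous ρ) {β : ℝ}
    {μ : Measure (LGConfig d G)} (hμ : μ ∈ infiniteVolumeLimitPoints (d := d) ρ β)
    (π : Equiv.Perm (Fin d)) :
    μ.map (configPermZd π) ∈ infiniteVolumeLimitPoints (d := d) ρ β := by
  obtain ⟨φ, hφ, hprob, hconv⟩ := hμ
  haveI := hprob
  refine ⟨φ, hφ, Measure.isProbabilityMeasure_map (configPermZd π).measurable.aemeasurable, ?_⟩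
  intro F S hFS hFc hFb
  rw [integral_map_equiv]
  have h := hconv (F ∘ configPermZd π) _ (IsCylinder.comp_configPermZd hFS π)
    (hFc.comp (continuous_configPermZd π))
    (by obtain ⟨C, hC⟩ := hFb; exact ⟨C, fun U => hC _⟩)
  have hE : ∀ L : ℕ, wilsonExpectation (L := L + 1) ρ β
      (toTorusObservable (L + 1) (F ∘ configPermZd π)) =
      wilsonExpectation (L := L + 1) ρ β (toTorusObservable (L + 1) F) := fun L => by
    rw [toTorusObservable_comp_configPermZd, wilsonExpectation_comp_configPerm ρ hρ]
  simp only [hE, Function.comp_apply] at h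
  exact h

omit [MeasurableSpace G] [TopologicalSpace G] [IsTopologicalGroup G] [CompactSpace G]
  [BorelSpace G] in
/-- The holonomy of a rectangular walk as the product of its four sides. [folklore] -/
theorem walkHolonomy_rectWalk (U : LGConfig d G) (x : Literature.Probability.LatticeModels.Site d)
    (i j : Fin d) (R T : ℕ) :
    walkHolonomy U (rectWalk x i j R T) =
      walkHolonomy U (lineWalk i R x) * walkHolonomy U (lineWalk j T (x + Pi.single i (R : ℤ))) *
        (walkHolonomy U (lineWalk i R (x + Pi.single j (T : ℤ))))⁻¹ *
          (walkHolonomy U (lineWalk j T x))⁻¹ := by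
  simp only [rectWalk, walkHolonomy_append, walkHolonomy_copy, walkHolonomy_reverse, mul_assoc]

omit [MeasurableSpace G] [TopologicalSpace G] [IsTopologicalGroup G] [CompactSpace G]
  [BorelSpace G] in
/-- Traversing the rectangle in the other order (`j` first) inverts the holonomy: the walk
`rectWalk x j i T R` is the reverse of `rectWalk x i j R T`. [folklore] -/
theorem walkHolonomy_rectWalk_swap (U : LGConfig d G) (x : Literature.Probability.LatticeModels.Site d)
    (i j : Fin d) (R T : ℕ) :
    walkHolonomy U (rectWalk x j i T R) = (walkHolonomy U (rectWalk x i j R T))⁻¹ := by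
  simp only [walkHolonomy_rectWalk, mul_inv_rev, inv_inv, mul_assoc]

omit [TopologicalSpace G] [IsTopologicalGroup G] [CompactSpace G] [BorelSpace G] in
/-- Straight walks of the permuted configuration. [folklore] -/
theorem walkHolonomy_configPermZd_lineWalk (π : Equiv.Perm (Fin d)) (U : LGConfig d G)
    (i : Fin d) : ∀ (n : ℕ) (x : Literature.Probability.LatticeModels.Site d),
    walkHolonomy (configPermZd π U) (lineWalk i n x) =
      walkHolonomy U (lineWalk (π.symm i) n (sitePermZd π.symm x))
  | 0, x => by simp [lineWalk]
  | n + 1, x => by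
    rw [lineWalk, walkHolonomy_cons, walkHolonomy_copy, walkHolonomy_configPermZd_lineWalk π U i n,
      dartHolonomy_add_single, lineWalk, walkHolonomy_cons, walkHolonomy_copy,
      dartHolonomy_add_single, configPermZd_apply, sitePermZd_add, sitePermZd_single]

omit [TopologicalSpace G] [IsTopologicalGroup G] [CompactSpace G] [BorelSpace G] in
/-- Rectangular walks of the permuted configuration. [folklore] -/
theorem walkHolonomy_configPermZd_rectWalk (π : Equiv.Perm (Fin d)) (U : LGConfig d G)
    (x : Literature.Probability.LatticeModels.Site d) (i j : Fin d) (R T : ℕ) :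
    walkHolonomy (configPermZd π U) (rectWalk x i j R T) =
      walkHolonomy U (rectWalk (sitePermZd π.symm x) (π.symm i) (π.symm j) R T) := by
  rw [walkHolonomy_rectWalk, walkHolonomy_rectWalk, walkHolonomy_configPermZd_lineWalk,
    walkHolonomy_configPermZd_lineWalk, walkHolonomy_configPermZd_lineWalk,
    walkHolonomy_configPermZd_lineWalk, sitePermZd_add, sitePermZd_add, sitePermZd_single,
    sitePermZd_single]

omit [TopologicalSpace G] [IsTopologicalGroup G] [CompactSpace G] [BorelSpace G] in
/-- **The `R × T` loop of `μ` is the `T × R` loop of the swapped state.** For an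
inversion-invariant class function `χ` (e.g. `(1/N) Re tr ρ`, `ρ` unitary or merely continuous on
a compact group), `W_μ(R, T)` in the `(0, 1)` plane equals `W_{σ_* μ}(T, R)` where `σ` swaps the
coordinates `0` and `1`. [folklore] -/
theorem rectExpectation_eq_swap [NeZero d] (μ : Measure (LGConfig d G)) (χ : G → ℝ)
    (hχ : ∀ g, χ g⁻¹ = χ g) (R T : ℕ) :
    rectExpectation μ χ 0 1 R T =
      rectExpectation (μ.map (configPermZd (Equiv.swap (0 : Fin d) 1))) χ 0 1 T R := by
  unfold rectExpectation loopExpectation wilsonLoopObs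
  rw [integral_map_equiv]
  refine integral_congr_ae (ae_of_all _ fun U => ?_)
  simp only
  rw [walkHolonomy_configPermZd_rectWalk, Equiv.symm_swap, sitePermZd_zero, Equiv.swap_apply_left,
    Equiv.swap_apply_right, walkHolonomy_rectWalk_swap, hχ]

end ZdPerm

end Literature.MathematicalPhysics.QuantumFieldTheory
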